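import Literature.Barriers.CriticalPhenomena.LongRangeTrivialityOnZ3WickReduction
import Literature.Probability.LatticeModels.TreeDiagramBoundCouplings

/-!
# The tree diagram bound for long-range pair interactions from its unit-coupling finite-graph form;
# the barrier `LongRangeTrivialityOnZ3` on the two random-current inputs of the nearest-neighbour
# barrier and the infrared bound

Sibling of `Literature/Barriers/CriticalPhenomena/LongRangeTrivialityOnZ3.lean` (barrier catalogue
D-0021, sub-problem `Ising3DConformalLimit`). `LongRangeTrivialityOnZ3TwoPoint.lean` vendors as the
named fact `panis_treeDiagramBound` the tree diagram bound of Panis 2023, §4.2 (display following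
Proposition 4.7; Aizenman 1982): `|U₄^β(x,y,z,t)| ≤ 2 ∑_{u∈ℤ^d} ⟨σ_xσ_u⟩_β⟨σ_yσ_u⟩_β⟨σ_zσ_u⟩_β⟨σ_tσ_u⟩_β`
for `J_{x,y} = C₀|x-y|₁^{-d-α}` and `0 < β ≤ β_c` (sum in `ℝ≥0∞`). The tree carries the same bound
for UNIT couplings on an arbitrary finite simple graph, `treeDiagramBound`
(`IsingTrivialityFromDimensionFour.lean`, Aizenman CDM 2020, Lemma 8.1), and
`Literature/Probability/LatticeModels/TreeDiagramBoundCouplings.lean` proves that the unit-coupling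
form implies the bound for every nonnegative pair coupling on a finite set
(`PairIsing.abs_ursellFour_le`, decoration transformation). Here:

* `LongRangeIsing.abs_ursellFourIn_le` — finite volume: for `J ≥ 0`, `β ≥ 0`, `Λ` finite and
  `u₀,…,u₃ ∈ Λ`, `|U₄^{Λ,β}(u)| ≤ 2∑_{v∈Λ} ∏_j ⟨σ_vσ_{u_j}⟩_{Λ,J,0,β}`;
* `LongRangeIsing.abs_ursellFour_le_tsum` — infinite volume along boxes (every `J ≥ 0`, `β ≥ 0`):
  `|U₄^β(x,y,z,t)| ≤ 2 ∑'_{u∈ℤ^d} ⟨σ_xσ_u⟩⟨σ_yσ_u⟩⟨σ_zσ_u⟩⟨σ_tσ_u⟩` in `ℝ≥0∞` — the finite-volume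
  two-point functions are dominated by the infinite-volume ones (Griffiths II in the volume,
  `expectIn_le_state`), the finite sum by the series, and `U₄^{Λ_L} → U₄` (`tendsto_ursellFourIn_box`);
* `panis_treeDiagramBound_of_unit : treeDiagramBound → panis_treeDiagramBound`;
* **`LongRangeTrivialityOnZ3.of_unitFacts : aizenman_wickDeviation_le_finite → treeDiagramBound →
  panis_infraredBound_algebraic → LongRangeTrivialityOnZ3`** — the long-range `ℤ³` barrier now rests
  on the two unit-coupling finite-graph random-current facts it shares with the nearest-neighbour
  `d ≥ 4` barrier `IsingTrivialityFromDimensionFour` (Aizenman's Prop. 12.1 and tree diagram bound)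
  and on the model-specific infrared bound (Panis 2023, Prop. 3.8).

## References

* R. Panis, arXiv:2309.05797 (2023) = Ann. Probab. 54 (2026), §4.2 (tree diagram bound) and
  Theorem 1.2 [Panis2023Triviality].
* M. Aizenman, CDM 2020, Lemma 8.1, eq. (8.2) [AizenmanCDM2020]; Comm. Math. Phys. 86 (1982)
  [AizenmanCMP1982] — through `IsingTrivialityFromDimensionFour.lean`.

## Tree anchors

`ursellFourIn`, `corrIn`, `pairIn`, `pairIn_eq`, `tendsto_ursellFourIn_box` (`…Wick`),
`corrIn_coe_eq_avg`, `pairIn_coe_eq_avg`, `LongRangeTrivialityOnZ3.of_unitWick` (`…WickReduction`),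
`PairIsing.abs_ursellFour_le` (`TreeDiagramBoundCouplings`), `expectIn_le_state`,
`expectIn_spinProduct_nonneg` (`…Proofs`), `pairCorrelation_eq`, `pairCorrelation_comm` (`…Inputs`,
`…TwoPoint`), `exists_forall_subset_box` (`GKSInequalities`), `ENNReal.sum_le_tsum`.
-/

noncomputable section

namespace Literature.Barriers.CriticalPhenomena

open Literature.Probability.LatticeModels Literature.Probability.Percolation Finset Filter Topology
open scoped symmDiff ENNReal

namespace LongRangeIsing

variable {d : ℕ} (J : Site d → Site d → ℝ) (Λ : Finset (Site d)) (β : ℝ)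

/-- **The tree diagram bound in finite volume for a general ferromagnetic pair interaction on
`ℤ^d`**, granted its unit-coupling finite-graph form: for `J ≥ 0`, `β ≥ 0` and `u₀,…,u₃ ∈ Λ`,
`|U₄^{Λ,β}(u)| ≤ 2∑_{v∈Λ} ∏_j ⟨σ_vσ_{u_j}⟩_{Λ,J,0,β}`. [cite: AizenmanCDM2020, Lemma 8.1, eq. (8.2)] [cite: Panis2023Triviality, §4.2 (tree diagram bound)] -/
theorem abs_ursellFourIn_le (hTB : treeDiagramBound) (hJ : ∀ x y, 0 ≤ J x y) (hβ : 0 ≤ β)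
    (u : Fin 4 → Site d) (hu : ∀ j, u j ∈ Λ) :
    |ursellFourIn J Λ β u| ≤ 2 * ∑ v ∈ Λ, ∏ j, pairIn J Λ β v (u j) := by
  set c : ↥Λ → ↥Λ → ℝ := fun a b => β / 2 * J a b with hc
  have hc0 : ∀ a b : ↥Λ, a ≠ b → 0 ≤ c a b := fun a b _ => mul_nonneg (div_nonneg hβ zero_le_two) (hJ _ _)
  set u' : Fin 4 → ↥Λ := fun j => ⟨u j, hu j⟩ with hu'
  have hU : ursellFourIn J Λ β u = PairIsing.ursellFour c u' := by
    have hN : corrIn J Λ β u = PairIsing.avg c (spinMonomial u') := corrIn_coe_eq_avg J Λ β u'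
    have h2 : ∀ i j, pairIn J Λ β (u i) (u j) = PairIsing.avg c (spinPair (u' i) (u' j)) :=
      fun i j => pairIn_coe_eq_avg J Λ β (u' i) (u' j)
    rw [ursellFourIn, PairIsing.ursellFour_def, hN, h2, h2, h2, h2, h2, h2]
  have hR : ∑ v ∈ Λ, ∏ j, pairIn J Λ β v (u j) = ∑ a : ↥Λ, ∏ j, PairIsing.avg c (spinPair a (u' j)) := by
    rw [← Finset.sum_coe_sort Λ]
    exact Finset.sum_congr rfl fun a _ => Finset.prod_congr rfl fun j _ => pairIn_coe_eq_avg J Λ β a (u' j)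
  rw [hU, hR]
  exact PairIsing.abs_ursellFour_le hTB c hc0 u'

variable {Λ}

/-- `0 ≤ ⟨σ_vσ_w⟩_{Λ,J,0,β} ≤ ⟨σ_vσ_w⟩_{J,0,β}` for `v, w ∈ Λ` (Griffiths I, and Griffiths II in the
volume along the boxes). [cite: Panis2023Triviality, §1.2.1 (infinite volume Gibbs measure by weak limits, Griffiths' inequalities)] -/
theorem pairIn_nonneg_and_le_pairCorrelation (hβ : 0 ≤ β) (hJ : ∀ x y, 0 ≤ J x y) {v w : Site d}
    (hv : v ∈ Λ) (hw : w ∈ Λ) :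
    0 ≤ pairIn J Λ β v w ∧ pairIn J Λ β v w ≤ pairCorrelation J β v w := by
  rw [pairIn_eq, pairCorrelation_eq]
  refine ⟨expectIn_spinProduct_nonneg J Λ β hβ hJ _, expectIn_le_state J β hβ hJ fun z hz => ?_⟩
  rcases Finset.mem_symmDiff.1 hz with ⟨h, -⟩ | ⟨h, -⟩
  · rw [Finset.mem_singleton.1 h]; exact hv
  · rw [Finset.mem_singleton.1 h]; exact hw

variable (Λ) in
/-- The finite-volume tree diagram dominated by the infinite-volume two-point functions:
`|U₄^{Λ,β}(u)| ≤ 2∑_{v∈Λ} ∏_j ⟨σ_{u_j}σ_v⟩_{J,0,β}`. [cite: Panis2023Triviality, §4.2 (tree diagram bound)] -/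
theorem abs_ursellFourIn_le_sum_pairCorrelation (hTB : treeDiagramBound) (hJ : ∀ x y, 0 ≤ J x y) (hβ : 0 ≤ β)
    (u : Fin 4 → Site d) (hu : ∀ j, u j ∈ Λ) :
    |ursellFourIn J Λ β u| ≤ 2 * ∑ v ∈ Λ, ∏ j, pairCorrelation J β (u j) v := by
  refine (abs_ursellFourIn_le J Λ β hTB hJ hβ u hu).trans ?_
  refine mul_le_mul_of_nonneg_left (Finset.sum_le_sum fun v hv => ?_) zero_le_two
  refine Finset.prod_le_prod (fun j _ => (pairIn_nonneg_and_le_pairCorrelation J β hβ hJ hv (hu j)).1)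
    fun j _ => ?_
  rw [pairCorrelation_comm]
  exact (pairIn_nonneg_and_le_pairCorrelation J β hβ hJ hv (hu j)).2

/-- **The tree diagram bound for the infinite-volume state of a ferromagnetic pair interaction on
`ℤ^d`** (`J ≥ 0`, `β ≥ 0`; `⟨·⟩_{J,0,β}` the limit along boxes), granted the unit-coupling finite-graph
form: `|U₄^β(x,y,z,t)| ≤ 2 ∑_{u∈ℤ^d} ⟨σ_xσ_u⟩⟨σ_yσ_u⟩⟨σ_zσ_u⟩⟨σ_tσ_u⟩`, the sum written in `ℝ≥0∞`
as in `panis_treeDiagramBound`. [cite: Panis2023Triviality, §4.2 (tree diagram bound, display following Proposition 4.7)] [cite: AizenmanCDM2020, Lemma 8.1, eq. (8.2)] -/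
theorem abs_ursellFour_le_tsum (hTB : treeDiagramBound) (hJ : ∀ x y, 0 ≤ J x y) (hβ : 0 ≤ β)
    (x y z t : Site d) :
    ENNReal.ofReal |ursellFour J β x y z t| ≤
      2 * ∑' u : Site d, ENNReal.ofReal
        (pairCorrelation J β x u * pairCorrelation J β y u * pairCorrelation J β z u * pairCorrelation J β t u) := by
  set w : Fin 4 → Site d := ![x, y, z, t] with hw
  obtain ⟨L₀, hL₀⟩ := exists_forall_subset_box d ({x, y, z, t} : Finset (Site d))
  have hmem : ∀ L, L₀ ≤ L → ∀ j, w j ∈ box d L := by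
    intro L hL j
    apply hL₀ L hL
    fin_cases j <;> simp [hw]
  have hprod : ∀ u : Site d, ∏ j, pairCorrelation J β (w j) u =
      pairCorrelation J β x u * pairCorrelation J β y u * pairCorrelation J β z u * pairCorrelation J β t u := by
    intro u
    rw [Fin.prod_univ_four]
    rfl
  have hlim : Tendsto (fun L : ℕ => ENNReal.ofReal |ursellFourIn J (box d L) β w|) atTop
      (𝓝 (ENNReal.ofReal |ursellFour J β x y z t|)) :=
    ENNReal.tendsto_ofReal (tendsto_ursellFourIn_box J β hβ hJ w).abs
  refine le_of_tendsto hlim ?_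
  filter_upwards [eventually_ge_atTop L₀] with L hL
  have h1 := abs_ursellFourIn_le_sum_pairCorrelation J (box d L) β hTB hJ hβ w (hmem L hL)
  have hnn : ∀ u, 0 ≤ ∏ j, pairCorrelation J β (w j) u :=
    fun u => Finset.prod_nonneg fun j _ => pairCorrelation_nonneg J β hβ hJ _ _
  calc ENNReal.ofReal |ursellFourIn J (box d L) β w|
      ≤ ENNReal.ofReal (2 * ∑ v ∈ box d L, ∏ j, pairCorrelation J β (w j) v) := ENNReal.ofReal_le_ofReal h1
    _ = 2 * ∑ v ∈ box d L, ENNReal.ofReal (∏ j, pairCorrelation J β (w j) v) := by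
        rw [ENNReal.ofReal_mul zero_le_two, ENNReal.ofReal_ofNat, ENNReal.ofReal_sum_of_nonneg fun v _ => hnn v]
    _ ≤ 2 * ∑' u : Site d, ENNReal.ofReal (∏ j, pairCorrelation J β (w j) u) := by
        gcongr
        exact ENNReal.sum_le_tsum _
    _ = _ := by simp_rw [hprod]

end LongRangeIsing

open LongRangeIsing

/-- **`panis_treeDiagramBound` from the unit-coupling finite-graph tree diagram bound** (in fact for
every `β > 0`; the restriction `β ≤ β_c` and the shape of `J` are not used beyond `J ≥ 0`).
[cite: Panis2023Triviality, §4.2 (tree diagram bound)] [cite: AizenmanCDM2020, Lemma 8.1] -/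
theorem panis_treeDiagramBound_of_unit (hTB : treeDiagramBound) : panis_treeDiagramBound :=
  fun d _ C₀ α hC₀ _ β hβ _ x y z t =>
    abs_ursellFour_le_tsum (algebraicCoupling d C₀ α) β hTB (algebraicCoupling_nonneg hC₀.le α) hβ.le x y z t

/-- **Theorem 1.2 of Panis 2023 at `d = 3` from the two unit-coupling finite-graph random-current
facts and the infrared bound.** [cite: Panis2023Triviality, Theorem 1.2 (d = 3)] -/
theorem panis_thm12_dim3_of_unitFacts (hW : aizenman_wickDeviation_le_finite) (hTB : treeDiagramBound)
    (hI : panis_infraredBound_algebraic) : panis_thm12_dim3 :=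
  panis_thm12_dim3_of_unitWick hW (panis_treeDiagramBound_of_unit hTB) hI

/-- **The barrier `LongRangeTrivialityOnZ3` from Aizenman's Prop. 12.1 and tree diagram bound for
unit couplings on finite graphs (`aizenman_wickDeviation_le_finite`, `treeDiagramBound` — the
random-current inputs of `IsingTrivialityFromDimensionFour`) and the infrared bound for
`C₀|x|₁^{-d-α}` (`panis_infraredBound_algebraic`).** [cite: Panis2023Triviality, Theorem 1.2 and proof of Theorem 5.5 (pp. 21–22)] -/
theorem LongRangeTrivialityOnZ3.of_unitFacts (hW : aizenman_wickDeviation_le_finite) (hTB : treeDiagramBound)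
    (hI : panis_infraredBound_algebraic) : LongRangeTrivialityOnZ3 :=
  LongRangeTrivialityOnZ3.of_unitWick hW (panis_treeDiagramBound_of_unit hTB) hI

end Literature.Barriers.CriticalPhenomena

end
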